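import Summits.BirchSwinnertonDyer.BirchSwinnertonDyer.Theorems.PrintCf2SplitBadTwoLocSurjLayerTrivialTransport
import Summits.BirchSwinnertonDyer.BirchSwinnertonDyer.Theorems.PrintCf2SplitBadTwoLayerFieldH1TransportCoeff
import Summits.BirchSwinnertonDyer.BirchSwinnertonDyer.Theorems.PrintCf2SplitBadTwoLayerLocSurjLevels
import HarnessLib

/-!
# Crux `PrintCf2.SplitBadTwoRankOneOfFacts` (stmt-BirchSwinnertonDyer-20368), S3n′-FACT-FREE road (a):
# (LSₙ) FOR θ = 1 IN THE LINE'S `U`-CURRENCY — the assembly (layer field Poitou–Tate ∘ Γ_F ≅ U bridge ∘ level transport)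

Cell `bsd-print-cf2`, WIDTH seat `bsd-line-cf2-p1-w7` g6 (prover-bsd-line-cf2-p1-w7-g6-0); `--supports
stmt-BirchSwinnertonDyer-20368` (helper, Theses-free). HONEST FRAMING: nothing here closes the crux or a registered stub;
BSD is not proved by any of this; no summit statement is proved by this seat. No definition, no named fact, no `sorry`.
UNCONDITIONAL.

WHAT (memos `R3-UPPER-BASELIFT-w4g12.md` §2, `R2-BRICKS-w5g7.md` §1). The hypothesis `hLSk` of `-w4` g12's
`UpperBaseLift.locSurj_layerSubgroup_of_forall_torsionExponent` — (SUR_U) at an open layer `U = Gal(K̄/L)` for TARGETS KILLED BY `p^k`,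
with a witness UNRAMIFIED at every other `w` with `p ∉ w ∨ w = v̄` — for a divisible discrete `Γ_K`-module `A` with TRIVIAL action
(`A_θ`, `θ = 1`), assembled from:
* the layer-field Poitou–Tate theorem `KummerProNull.exists_selmer_sub_localMap_mem_of_trivial_of_addEquiv` (p703454; (PRO-NULL) from
  Leopoldt/Brumer inside), here first re-indexed by an injective family of target places (`…_indexed`);
* `-w6` g6's Γ_F ≅ U bridge: `LayerFieldPlaces.exists_equiv_doubleCoset_extension` (p703911: `D_w \ Γ_K / U ≃ {w' ∣ w}`),
  `LayerFieldH1.exists_addEquiv_subgroupH1_galoisCohomology` (p704667: `Θ : H¹(U, N) ≃ H¹(Γ_L, N|res)`),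
  `LayerFieldH1.exists_transport_of_conj` / `exists_contIntertwiningMap_restrictField` (p705894: local transports `Ψ₀, Ψ`, (β1)–(β3), (α′));
* `-w5` g7's level transport `LayerShapiro.exists_resH1Hom_eq_of_nsmul_eq_zero`, `resOfLe_sub_eq_zero_of_level`,
  `forall_conjH1_resH1Hom_mem_unramifiedKer` (p703310).
Output: **`locSurj_level_of_trivial`** — `∀ k ∃ M ≥ k` such that for all trivial discrete `Γ_K`-modules `N₀ ≃+ ℤ/p^k`, `N ≃+ ℤ/p^M`, `A`,
maps `j : N₀ → N`, `ι : N → A`, `ι₀ = ι ∘ j : N₀ ↪ A` onto `A[p^k]` (`A` `p^k`-divisible), every finite `T` with `p ∉ w ∨ w = v̄` on `T`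
and all targets `τ w q ∈ H¹(U ⊓ D_w, A)` killed by `p^k`: `∃ z ∈ H¹(U, A)`, [hit mod inertia on `T`] ∧ [all conjugates unramified off `T`]
— `hLSk`'s body VERBATIM at `U = galFixing K L`. beyond-print theorem: no. presearch: NOTES.md.

References: Milne, *ADT* I Thm. 4.10; Greenberg–Vatsal (2000) Prop. 2.1; Greenberg, LNM 1716 Props. 4.13–4.15; Serre, *Galois Cohomology* I §2.5.
-/

noncomputable section

set_option linter.dupNamespace false
set_option autoImplicit false

open scoped Classical ContRepresentation Pointwise
open NumberField IsDedekindDomain Field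
open Literature.NumberTheory.GaloisRepresentations Literature.NumberTheory.GaloisRepresentations.LocalWeilDatum
open Literature.NumberTheory.GaloisRepresentations.DiscreteGaloisModule
open Literature.NumberTheory.GaloisCohomology
open Literature.NumberTheory.EllipticCurves Literature.NumberTheory.EllipticCurves.GreenbergSelmer
open Literature.NumberTheory.EllipticCurves.GreenbergVatsal2000
open Summit.BirchSwinnertonDyer.Rank1Residual.X11b
open Summit.BirchSwinnertonDyer.BirchSwinnertonDyer.Theorems.PrintCf2.LocalGroupsBridge
open Summit.BirchSwinnertonDyer.BirchSwinnertonDyer.Theorems.PrintCf2.LayerFieldPlaces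
open Summit.BirchSwinnertonDyer.BirchSwinnertonDyer.Theorems.PrintCf2.LayerFieldH1
open Summit.BirchSwinnertonDyer.BirchSwinnertonDyer.Theorems.PrintCf2.LayerShapiro

namespace Summit.BirchSwinnertonDyer.BirchSwinnertonDyer.Theorems.PrintCf2.KummerProNull

variable {K : Type} [Field K] [NumberField K] {p : ℕ} [hp : Fact p.Prime]

/-- **(SUR_n) over the layer field with an INDEXED family of targets.** `exists_selmer_sub_localMap_mem_of_trivial_of_addEquiv` (p703454)
with the targets given on an injective family of finite places `ιdx : I → {places of F}` (the index set of the line: pairs `(w, q)`,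
`q ∈ D_w \ Γ_K / U`), and the witness unramified (`∈ 𝓕`) at every place of `S` off the family. [cite: MilneADT2006, Ch. I, Thm. 4.10 (b)] -/
theorem exists_selmer_sub_localMap_mem_of_trivial_indexed (hK : IsImaginaryQuadratic K)
    {v vbar : HeightOneSpectrum (𝓞 K)} (hv : ((p : ℕ) : 𝓞 K) ∈ v.asIdeal) (hvbar : ((p : ℕ) : 𝓞 K) ∈ vbar.asIdeal)
    (hne : vbar ≠ v) (F : IntermediateField K (AlgebraicClosure K)) [FiniteDimensional K F] [IsAbelianGalois K F]
    [NumberField F] (k : ℕ) :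
    ∃ M : ℕ, k ≤ M ∧ ∀ {N₀ N : Type} [AddCommGroup N₀] [TopologicalSpace N₀] [DiscreteTopology N₀]
      [AddCommGroup N] [TopologicalSpace N] [DiscreteTopology N]
      (ρ₀ : DiscreteGaloisModule F N₀) (ρ : DiscreteGaloisModule F N)
      (_hρ₀ : ∀ (σ : absoluteGaloisGroup F) (m : N₀), ρ₀ σ m = m)
      (_hρ : ∀ (σ : absoluteGaloisGroup F) (m : N), ρ σ m = m)
      (e₀ : N₀ ≃+ ZMod (p ^ k)) (e : N ≃+ ZMod (p ^ M))
      (ι : ρ₀.toContRepresentation →ⁱL ρ.toContRepresentation)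
      (_hι : e (ι (e₀.symm 1)) = ((p ^ (M - k) : ℕ) : ZMod (p ^ M)))
      (𝓕 : SelmerStructure ρ)
      (_h𝓕v : ∀ w : HeightOneSpectrum (𝓞 F), w.under (𝓞 K) = v → 𝓕 (Sum.inr w) = ⊤)
      (_h𝓕 : ∀ w : HeightOneSpectrum (𝓞 F), w.under (𝓞 K) ≠ v →
        𝓕 (Sum.inr w) = unramifiedSubgroup (GaloisRep.toLocal w ρ) 1)
      (S : Finset (Place F))
      (_hSp : ∀ w : HeightOneSpectrum (𝓞 F), ((p : ℕ) : 𝓞 F) ∈ w.asIdeal → (Sum.inr w : Place F) ∈ S)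
      (_hS : ∀ w : InfinitePlace F, (Sum.inl w : Place F) ∈ S)
      (𝓖 : SelmerStructure ρ) (_hle : 𝓕 ≤ 𝓖) (_h𝓖 : 𝓖.IsUnramifiedOutside S)
      {I : Type} (ιdx : I → HeightOneSpectrum (𝓞 F)) (_hinj : Function.Injective ιdx)
      (t : Π i : I, galoisCohomology (ρ₀.toLocal (Sum.inr (ιdx i))) 1)
      (_ht : ∀ i, localMap ι (Sum.inr (ιdx i)) (t i) ∈ 𝓖 (Sum.inr (ιdx i))),
      ∃ x ∈ 𝓖.selmerGroup,
        (∀ i, galoisCohomology.localization ρ (Sum.inr (ιdx i)) 1 x - localMap ι (Sum.inr (ιdx i)) (t i) ∈ 𝓕 (Sum.inr (ιdx i))) ∧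
        (∀ w ∈ S, (∀ i, w ≠ Sum.inr (ιdx i)) → galoisCohomology.localization ρ w 1 x ∈ 𝓕 w) := by
  obtain ⟨M, hkM, hM⟩ := exists_selmer_sub_localMap_mem_of_trivial_of_addEquiv (p := p) hK hv hvbar hne F k
  refine ⟨M, hkM, ?_⟩
  intro N₀ N _ _ _ _ _ _ ρ₀ ρ hρ₀ hρ e₀ e ι hι 𝓕 h𝓕v h𝓕 S hSp hSinf 𝓖 hle h𝓖 I ιdx hinj t ht
  -- the total family of targets: `t i` at `ιdx i`, `0` elsewhere
  let s : Π w : Place F, galoisCohomology (ρ₀.toLocal w) 1 := fun w ↦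
    match w with
    | Sum.inr w' => if h : ∃ i, ιdx i = w' then h.choose_spec ▸ t h.choose else 0
    | Sum.inl _ => 0
  have hs_idx : ∀ i, s (Sum.inr (ιdx i)) = t i := by
    intro i
    have h : ∃ i', ιdx i' = ιdx i := ⟨i, rfl⟩
    have key : ∀ (i' : I) (e' : ιdx i' = ιdx i), e' ▸ t i' = t i := by
      intro i' e'
      obtain rfl : i' = i := hinj e'
      rfl
    change (if h : ∃ i', ιdx i' = ιdx i then h.choose_spec ▸ t h.choose else 0) = t i
    rw [dif_pos h]
    exact key _ _
  have hs_off : ∀ w' : HeightOneSpectrum (𝓞 F), (∀ i, ιdx i ≠ w') → s (Sum.inr w') = 0 := by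
    intro w' hw'
    change (if h : ∃ i, ιdx i = w' then h.choose_spec ▸ t h.choose else 0) = 0
    rw [dif_neg (not_exists.mpr hw')]
  have hs_inl : ∀ w : InfinitePlace F, s (Sum.inl w) = 0 := fun _ ↦ rfl
  have hsG : ∀ w ∈ S, localMap ι w (s w) ∈ 𝓖 w := by
    intro w _
    rcases w with winf | w'
    · rw [hs_inl, map_zero]; exact zero_mem _
    · by_cases h : ∃ i, ιdx i = w'
      · obtain ⟨i, rfl⟩ := h
        rw [hs_idx]; exact ht i
      · rw [hs_off w' (not_exists.mp h), map_zero]; exact zero_mem _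
  obtain ⟨x, hx, hxS⟩ := hM ρ₀ ρ hρ₀ hρ e₀ e ι hι 𝓕 h𝓕v h𝓕 S hSp hSinf 𝓖 hle h𝓖 s hsG
  -- targets not in `S` are hit anyway: there `𝓖 = 𝓕 = H¹_ur ∋ loc x` and the statement is about `𝓕`; but we only claim it on `S`
  refine ⟨x, hx, fun i ↦ ?_, fun w hw hwi ↦ ?_⟩
  · by_cases hiS : (Sum.inr (ιdx i) : Place F) ∈ S
    · have h := hxS _ hiS
      rwa [hs_idx] at h
    · -- off `S`: `𝓖 = H¹_ur = 𝓕` there, so `loc x ∈ 𝓕` and the target `H¹(ι) t i ∈ 𝓖 = 𝓕`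
      have hG := h𝓖.2 (ιdx i) hiS
      have hFv : (ιdx i).under (𝓞 K) ≠ v := by
        intro hiv
        apply hiS
        apply hSp
        have h1 : ((p : ℕ) : 𝓞 K) ∈ ((ιdx i).under (𝓞 K)).asIdeal := hiv ▸ hv
        rw [HeightOneSpectrum.under_asIdeal, Ideal.under_def, Ideal.mem_comap, map_natCast] at h1
        exact h1
      have hF := h𝓕 (ιdx i) hFv
      have hlx : galoisCohomology.localization ρ (Sum.inr (ιdx i)) 1 x ∈ 𝓕 (Sum.inr (ιdx i)) := by
        rw [hF, ← hG]; exact (SelmerStructure.mem_selmerGroup_iff _ _).mp hx _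
      have hti : localMap ι (Sum.inr (ιdx i)) (t i) ∈ 𝓕 (Sum.inr (ιdx i)) := by
        rw [hF, ← hG]; exact ht i
      exact sub_mem hlx hti
  · rcases w with winf | w'
    · have h := hxS _ hw
      rwa [hs_inl, map_zero, sub_zero] at h
    · have h := hxS _ hw
      rwa [hs_off w' (fun i hi ↦ hwi i (by rw [hi])), map_zero, sub_zero] at h

/-- **(LSₙ) for θ = 1 in `U`-currency** — the body of `-w4` g12's `hLSk` (`UpperBaseLift.locSurj_layerSubgroup_of_forall_torsionExponent`)
at the open layer `U = Gal(K̄/L)` (`hUL : galFixing K L = U`; for the line: `U := κ₂.layerSubgroup n`, `L := κ₂.layer n`, tree `galFixing_layer`),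
for a discrete `Γ_K`-module `A` with TRIVIAL action, `p^k`-divisible, with level pieces `ι₀ : N₀ ≃ A[p^k] ↪ A`, `ι : N ↪ A`, `ι ∘ j = ι₀`,
`N₀ ≃+ ℤ/p^k`, `N ≃+ ℤ/p^M` (`e (j (e₀⁻¹ 1)) = p^{M−k}`): for every finite `T` with `p ∉ w ∨ w = v̄` on `T` and all targets
`τ w q ∈ H¹(U ⊓ D_w, A)` killed by `p^k`, some `z ∈ H¹(U, A)` hits every target modulo the classes vanishing on `U ⊓ I_w` and has all its
conjugates unramified at every `w ∉ T` with `p ∉ w ∨ w = v̄`. Assembly: layer-field Poitou–Tate (p703454) ∘ `-w6` g6's Γ_F ≅ U bridge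
(p703911, p704667, p705894) ∘ `-w5` g7's level transport (p703310). [cite: GreenbergVatsal2000, Prop. 2.1] [cite: MilneADT2006, Ch. I, Thm. 4.10 (b)]
[cite: GreenbergLNM1716, §4 Props. 4.13–4.15] -/
theorem locSurj_level_of_trivial (hK : IsImaginaryQuadratic K) {v vbar : HeightOneSpectrum (𝓞 K)}
    (hv : ((p : ℕ) : 𝓞 K) ∈ v.asIdeal) (hvbar : ((p : ℕ) : 𝓞 K) ∈ vbar.asIdeal) (hne : vbar ≠ v)
    (L : IntermediateField K (AlgebraicClosure K)) [FiniteDimensional K L] [IsAbelianGalois K L] [NumberField L] [Normal K L]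
    (U : Subgroup (absoluteGaloisGroup K)) [U.Normal] (hUL : galFixing K L = U) (k : ℕ) :
    ∃ M : ℕ, k ≤ M ∧ ∀ {N₀ N A : Type}
      [AddCommGroup N₀] [DistribMulAction (absoluteGaloisGroup K) N₀] [TopologicalSpace N₀] [DiscreteTopology N₀]
      [AddCommGroup N] [DistribMulAction (absoluteGaloisGroup K) N] [TopologicalSpace N] [DiscreteTopology N]
      [AddCommGroup A] [DistribMulAction (absoluteGaloisGroup K) A] [TopologicalSpace A] [DiscreteTopology A]
      (_htriv₀ : ∀ (σ : absoluteGaloisGroup K) (m : N₀), σ • m = m)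
      (_htrivN : ∀ (σ : absoluteGaloisGroup K) (m : N), σ • m = m)
      (_htrivA : ∀ (σ : absoluteGaloisGroup K) (a : A), σ • a = a)
      (e₀ : N₀ ≃+ ZMod (p ^ k)) (e : N ≃+ ZMod (p ^ M)) (j : N₀ →+ N)
      (_hje : e (j (e₀.symm 1)) = ((p ^ (M - k) : ℕ) : ZMod (p ^ M)))
      (ι : N →+ A) (ι₀ : N₀ →+ A) (_hcomp : ∀ m, ι (j m) = ι₀ m) (_hι₀ : Function.Injective ι₀)
      (_hrange : ∀ a : A, p ^ k • a = 0 → ∃ m, ι₀ m = a) (_hdiv : ∀ a : A, ∃ b : A, p ^ k • b = a)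
      (T : Finset (HeightOneSpectrum (𝓞 K))) (_hT : ∀ w ∈ T, ((p : ℕ) : 𝓞 K) ∉ w.asIdeal ∨ w = vbar)
      (τ : (w : HeightOneSpectrum (𝓞 K)) →
        DoubleCoset.Quotient (decomp (K := K) w : Set (absoluteGaloisGroup K)) (U : Set (absoluteGaloisGroup K)) →
          subgroupH1 (decompIn U w) A)
      (_hτ : ∀ w ∈ T, ∀ q, p ^ k • τ w q = 0),
      ∃ z : subgroupH1 U A,
        (∀ w ∈ T, ∀ q : DoubleCoset.Quotient (decomp (K := K) w : Set (absoluteGaloisGroup K)) (U : Set (absoluteGaloisGroup K)),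
          resOfLe A (inertiaIn_le_decompIn U w)
            (resH1Hom (decompInToH U w) (AddMonoidHom.id A) (fun _ _ ↦ rfl) (conjH1 U A q.out z) - τ w q) = 0) ∧
        (∀ w : HeightOneSpectrum (𝓞 K), w ∉ T → (((p : ℕ) : 𝓞 K) ∉ w.asIdeal ∨ w = vbar) →
          ∀ σ : absoluteGaloisGroup K, conjH1 U A σ z ∈ GreenbergVatsal2000.unramifiedKer U A w) := by
  obtain ⟨M, hkM, hM⟩ := exists_selmer_sub_localMap_mem_of_trivial_indexed (p := p) hK hv hvbar hne L k
  refine ⟨M, hkM, ?_⟩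
  intro N₀ N A _ _ _ _ _ _ _ _ _ _ _ _ htriv₀ htrivN htrivA e₀ e j hje ι ι₀ hcomp hι₀ hrange hdiv T hT τ hτ
  subst hUL
  -- trivial actions: open stabilisers and equivariance
  have hN₀ : ∀ m : N₀, IsOpen {σ : absoluteGaloisGroup K | σ • m = m} := fun m ↦ by
    simp only [htriv₀, Set.setOf_true, isOpen_univ]
  have hN : ∀ m : N, IsOpen {σ : absoluteGaloisGroup K | σ • m = m} := fun m ↦ by
    simp only [htrivN, Set.setOf_true, isOpen_univ]
  have hj : ∀ (σ : absoluteGaloisGroup K) (m : N₀), j (σ • m) = σ • j m := fun σ m ↦ by rw [htriv₀, htrivN]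
  have hι : ∀ (σ : absoluteGaloisGroup K) (m : N), ι (σ • m) = σ • ι m := fun σ m ↦ by rw [htrivN, htrivA]
  have hι₀' : ∀ (σ : absoluteGaloisGroup K) (m : N₀), ι₀ (σ • m) = σ • ι₀ m := fun σ m ↦ by rw [htriv₀, htrivA]
  have hAG : ∀ (w : HeightOneSpectrum (𝓞 K)) (a : A),
      IsOpen (MulAction.stabilizer (decompIn (galFixing K L) w) a : Set (decompIn (galFixing K L) w)) := fun w a ↦ by
    have h : (MulAction.stabilizer (decompIn (galFixing K L) w) a : Set (decompIn (galFixing K L) w)) = Set.univ :=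
      Set.eq_univ_iff_forall.mpr fun g ↦ htrivA _ a
    rw [h]; exact isOpen_univ
  have hw_ne_v : ∀ w : HeightOneSpectrum (𝓞 K), (((p : ℕ) : 𝓞 K) ∉ w.asIdeal ∨ w = vbar) → w ≠ v := by
    rintro w (h | h) rfl
    · exact h hv
    · exact hne h.symm
  -- the Γ_F ≅ U bridge of -w6 g6
  have hU : (absGaloisRestrict K L).toMonoidHom.range = galFixing K L := range_absGaloisRestrict_eq_galFixing L
  obtain ⟨Θ, hΘ⟩ := exists_addEquiv_subgroupH1_galoisCohomology L (galFixing K L) hU N hN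
  obtain ⟨jL, hjL⟩ := exists_contIntertwiningMap_restrictField L N₀ hN₀ N hN j hj
  have hf := fun w : HeightOneSpectrum (𝓞 K) ↦ exists_equiv_doubleCoset_extension L w
  choose f _hf1 hf2 using hf
  choose τ' hD hI using hf2
  have hpack := fun (w : HeightOneSpectrum (𝓞 K)) (σ : absoluteGaloisGroup K) ↦
    exists_transport_of_conj L (galFixing K L) hU N₀ hN₀ N hN j hj w σ _ (τ' w σ) (hD w σ) (hI w σ) Θ hΘ jL hjL
  choose Ψ₀ Ψ hβ1 hα hβ2 _hβ2₀ _hinjΨ _hinjΨ₀ hβ3 using hpack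
  -- the layer-field modules are trivial
  have hρ₀ : ∀ (σ : absoluteGaloisGroup L) (m : N₀), ((LocBridge.ofSMul N₀ hN₀).restrictField L) σ m = m := fun σ m ↦ by
    rw [GaloisRep.restrictField_apply, LocBridge.ofSMul_apply_apply, htriv₀]
  have hρ : ∀ (σ : absoluteGaloisGroup L) (m : N), ((LocBridge.ofSMul N hN).restrictField L) σ m = m := fun σ m ↦ by
    rw [GaloisRep.restrictField_apply, LocBridge.ofSMul_apply_apply, htrivN]
  have hjeL : e (jL (e₀.symm 1)) = ((p ^ (M - k) : ℕ) : ZMod (p ^ M)) := by rw [hjL]; exact hje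
  -- level-k lifts of the targets (B3 §1)
  have hdesc : ∀ (w : {w // w ∈ T})
      (q : DoubleCoset.Quotient (decomp (K := K) w.1 : Set (absoluteGaloisGroup K)) (galFixing K L : Set (absoluteGaloisGroup K))),
      ∃ y : subgroupH1 (decompIn (galFixing K L) w.1) N₀,
        resH1Hom (ContinuousMonoidHom.id (decompIn (galFixing K L) w.1)) ι₀ (fun g m ↦ hι₀' g m) y = τ w.1 q :=
    fun w q ↦ exists_resH1Hom_eq_of_nsmul_eq_zero (hAG w.1) ι₀ (fun g m ↦ hι₀' g m) hι₀ (p ^ k) hrange hdiv (τ w.1 q) (hτ w.1 w.2 q)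
  choose τt hτt using hdesc
  -- the Selmer structures on the layer field: `⊤` above `v`, `H¹_ur` elsewhere; `𝓖 = 𝓕` relaxed above `T`
  let 𝓕 : SelmerStructure ((LocBridge.ofSMul N hN).restrictField L) := fun wL ↦
    match wL with
    | Sum.inr w' => if w'.under (𝓞 K) = v then ⊤
        else unramifiedSubgroup (GaloisRep.toLocal w' ((LocBridge.ofSMul N hN).restrictField L)) 1
    | Sum.inl _ => ⊤
  have h𝓕v : ∀ w' : HeightOneSpectrum (𝓞 L), w'.under (𝓞 K) = v → 𝓕 (Sum.inr w') = ⊤ := fun w' h ↦ by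
    change (if w'.under (𝓞 K) = v then ⊤ else _) = ⊤; rw [if_pos h]
  have h𝓕 : ∀ w' : HeightOneSpectrum (𝓞 L), w'.under (𝓞 K) ≠ v →
      𝓕 (Sum.inr w') = unramifiedSubgroup (GaloisRep.toLocal w' ((LocBridge.ofSMul N hN).restrictField L)) 1 := fun w' h ↦ by
    change (if w'.under (𝓞 K) = v then ⊤ else _) = _; rw [if_neg h]
  let 𝓖 : SelmerStructure ((LocBridge.ofSMul N hN).restrictField L) := fun wL ↦
    match wL with
    | Sum.inr w' => if w'.under (𝓞 K) ∈ T then ⊤ else 𝓕 (Sum.inr w')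
    | Sum.inl _ => ⊤
  have h𝓖T : ∀ w' : HeightOneSpectrum (𝓞 L), w'.under (𝓞 K) ∈ T → 𝓖 (Sum.inr w') = ⊤ := fun w' h ↦ by
    change (if w'.under (𝓞 K) ∈ T then ⊤ else _) = ⊤; rw [if_pos h]
  have h𝓖nT : ∀ w' : HeightOneSpectrum (𝓞 L), w'.under (𝓞 K) ∉ T → 𝓖 (Sum.inr w') = 𝓕 (Sum.inr w') := fun w' h ↦ by
    change (if w'.under (𝓞 K) ∈ T then ⊤ else _) = _; rw [if_neg h]
  have hle : 𝓕 ≤ 𝓖 := by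
    rintro (winf | w')
    · exact le_top
    · by_cases h : w'.under (𝓞 K) ∈ T
      · rw [h𝓖T w' h]; exact le_top
      · rw [h𝓖nT w' h]
  -- the finite set `S` of places of `L`: above `T`, above `p`, and the infinite ones
  have hunder_p : ∀ w' : HeightOneSpectrum (𝓞 L), ((p : ℕ) : 𝓞 L) ∈ w'.asIdeal ↔ ((p : ℕ) : 𝓞 K) ∈ (w'.under (𝓞 K)).asIdeal :=
    fun w' ↦ by rw [HeightOneSpectrum.under_asIdeal, Ideal.under_def, Ideal.mem_comap, map_natCast]
  have hfinP : {u : HeightOneSpectrum (𝓞 K) | ((p : ℕ) : 𝓞 K) ∈ u.asIdeal}.Finite := by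
    have hp0 : (Ideal.span {((p : ℕ) : 𝓞 K)} : Ideal (𝓞 K)) ≠ ⊥ := by
      rw [Ne, Ideal.span_singleton_eq_bot]; exact_mod_cast hp.out.ne_zero
    exact (Ideal.finite_factors hp0).subset fun u hu ↦ (Ideal.dvd_span_singleton).mpr hu
  have hfinL : {w' : HeightOneSpectrum (𝓞 L) | w'.under (𝓞 K) ∈ T ∨ ((p : ℕ) : 𝓞 K) ∈ (w'.under (𝓞 K)).asIdeal}.Finite := by
    have key : ∀ u : HeightOneSpectrum (𝓞 K), {w' : HeightOneSpectrum (𝓞 L) | w'.under (𝓞 K) = u}.Finite := fun u ↦ by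
      refine ((IsDedekindDomain.primesOver_finite u.asIdeal (𝓞 L)).preimage fun _ _ _ _ h ↦ HeightOneSpectrum.ext h).subset ?_
      intro w' hw'
      exact ⟨w'.isPrime, ⟨by rw [← (hw' : w'.under (𝓞 K) = u)]; rfl⟩⟩
    refine (((T.finite_toSet).union hfinP).biUnion fun u _ ↦ key u).subset ?_
    intro w' hw'
    simp only [Set.mem_iUnion, Set.mem_setOf_eq, Set.mem_union, Finset.mem_coe, exists_prop]
    rcases hw' with h | h
    · exact ⟨_, Or.inl h, rfl⟩
    · exact ⟨_, Or.inr h, rfl⟩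
  let S : Finset (Place L) := hfinL.toFinset.image Sum.inr ∪ Finset.univ.image Sum.inl
  have hS_inr : ∀ w' : HeightOneSpectrum (𝓞 L), (Sum.inr w' : Place L) ∈ S ↔
      (w'.under (𝓞 K) ∈ T ∨ ((p : ℕ) : 𝓞 K) ∈ (w'.under (𝓞 K)).asIdeal) := fun w' ↦ by
    simp only [S, Finset.mem_union, Finset.mem_image, Set.Finite.mem_toFinset, Set.mem_setOf_eq, Finset.mem_univ,
      true_and, Sum.inr.injEq, exists_eq_right, reduceCtorEq, exists_false, or_false]
  have hSp : ∀ w' : HeightOneSpectrum (𝓞 L), ((p : ℕ) : 𝓞 L) ∈ w'.asIdeal → (Sum.inr w' : Place L) ∈ S :=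
    fun w' h ↦ (hS_inr w').mpr (Or.inr ((hunder_p w').mp h))
  have hSinf : ∀ w : InfinitePlace L, (Sum.inl w : Place L) ∈ S := fun w ↦
    Finset.mem_union_right _ (Finset.mem_image.mpr ⟨w, Finset.mem_univ _, rfl⟩)
  have h𝓖 : 𝓖.IsUnramifiedOutside S := by
    refine ⟨hSinf, fun w' hw' ↦ ?_⟩
    rw [hS_inr, not_or] at hw'
    rw [h𝓖nT w' hw'.1, h𝓕 w' fun h ↦ hw'.2 (h ▸ hv)]
  -- index set of the targets: pairs `(w ∈ T, q)`, placed at `f w (mk q.out)`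
  let ιdx : (Σ w : {w // w ∈ T}, DoubleCoset.Quotient (decomp (K := K) w.1 : Set (absoluteGaloisGroup K))
      (galFixing K L : Set (absoluteGaloisGroup K))) → HeightOneSpectrum (𝓞 L) :=
    fun i ↦ (f i.1.1 (DoubleCoset.mk (decomp (K := K) i.1.1) (galFixing K L) i.2.out)).1
  have hmk : ∀ (w : HeightOneSpectrum (𝓞 K))
      (q : DoubleCoset.Quotient (decomp (K := K) w : Set (absoluteGaloisGroup K)) (galFixing K L : Set (absoluteGaloisGroup K))),
      DoubleCoset.mk (decomp (K := K) w) (galFixing K L) q.out = q := fun w q ↦ Quotient.out_eq' q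
  have hinj : Function.Injective ιdx := by
    rintro ⟨⟨w, hw⟩, q⟩ ⟨⟨w', hw'⟩, q'⟩ h
    change (f w _).1 = (f w' _).1 at h
    have hww : w = w' := by rw [← (f w (DoubleCoset.mk _ _ q.out)).2, ← (f w' (DoubleCoset.mk _ _ q'.out)).2, h]
    subst hww
    have hqq : q = q' := by
      have h2 := (f w).injective (Subtype.ext h)
      rwa [hmk, hmk] at h2
    subst hqq
    rfl
  -- targets on the layer field and their membership in `𝓖 = ⊤` above `T`
  obtain ⟨x, hx, hx1, _hx2⟩ := hM ((LocBridge.ofSMul N₀ hN₀).restrictField L) ((LocBridge.ofSMul N hN).restrictField L)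
    hρ₀ hρ e₀ e jL hjeL 𝓕 h𝓕v h𝓕 S hSp hSinf 𝓖 hle h𝓖 ιdx hinj (fun i ↦ Ψ₀ i.1.1 i.2.out (τt i.1 i.2)) (fun i ↦ by
      rw [h𝓖T _ (by rw [(f _ _).2]; exact i.1.2)]; exact AddSubgroup.mem_top _)
  -- the witness: pull back along `Θ`, push the coefficients to `A`
  refine ⟨resH1Hom (ContinuousMonoidHom.id (galFixing K L)) ι (fun g m ↦ hι g m) (Θ.symm x), fun w hw q ↦ ?_,
    fun w hwT hw σ ↦ ?_⟩
  · -- clause 1: the target at `(w, q)` is hit modulo the classes vanishing on `U ⊓ I_w`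
    have h1 := hx1 ⟨⟨w, hw⟩, q⟩
    have hFw : 𝓕 (Sum.inr (ιdx ⟨⟨w, hw⟩, q⟩)) = unramifiedSubgroup (GaloisRep.toLocal _ ((LocBridge.ofSMul N hN).restrictField L)) 1 :=
      h𝓕 _ (by rw [(f _ _).2]; exact hw_ne_v w (hT w hw))
    rw [hFw, show x = Θ (Θ.symm x) from (Θ.apply_symm_apply x).symm] at h1
    change galoisCohomology.localization _ (Sum.inr (f w (DoubleCoset.mk _ _ q.out)).1) 1 (Θ (Θ.symm x)) -
      localMap jL (Sum.inr (f w (DoubleCoset.mk _ _ q.out)).1) (Ψ₀ w q.out (τt ⟨w, hw⟩ q)) ∈ _ at h1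
    rw [← hβ1 w q.out (Θ.symm x), hβ3 w q.out] at h1
    change Ψ w q.out _ - Ψ w q.out _ ∈ unramifiedSubgroup (GaloisRep.toLocal (f w (DoubleCoset.mk _ _ q.out)).1
      ((LocBridge.ofSMul N hN).restrictField L)) 1 at h1
    rw [← map_sub, hβ2 w q.out] at h1
    have h2 := resOfLe_sub_eq_zero_of_level (U := galFixing K L) (w := w) (ι := ι) (hι := hι) j hj ι₀ hι₀' hcomp q
      (Θ.symm x) (τt ⟨w, hw⟩ q) h1
    rwa [hτt ⟨w, hw⟩ q] at h2
  · -- clause 2: all conjugates are unramified at `w ∉ T`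
    refine forall_conjH1_resH1Hom_mem_unramifiedKer (U := galFixing K L) (w := w) (ι := ι) (hι := hι) (fun σ' ↦ ?_) σ
    refine (hα w σ' (Θ.symm x)).mpr ?_
    rw [Θ.apply_symm_apply]
    have hw' : (f w (DoubleCoset.mk (decomp (K := K) w) (galFixing K L) σ')).1.under (𝓞 K) = w := (f w _).2
    have hmem := (SelmerStructure.mem_selmerGroup_iff _ _).mp hx (Sum.inr (f w (DoubleCoset.mk _ _ σ')).1)
    rwa [h𝓖nT _ (by rw [hw']; exact hwT), h𝓕 _ (by rw [hw']; exact hw_ne_v w hw)] at hmem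

end Summit.BirchSwinnertonDyer.BirchSwinnertonDyer.Theorems.PrintCf2.KummerProNull

end
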